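import Summits.ResolutionOfSingularities.ResolutionOfSingularities.Theorems.PurelyInseparableDim4ChartAtlasSNCMultishear
import Summits.ResolutionOfSingularities.ResolutionOfSingularities.Theorems.PurelyInseparableDim4ChartAtlasSNCRepairStep
import Literature.AlgebraicGeometry.Resolution.MarkedIdealsRestrict
import HarnessLib

/-!
# Boundary members MISSING the centre are harmless for simple normal crossings; the boundary AFTER the repair blow-up is snc with
# the surviving centre on its chart (S3-N2 repair, chart level; cell `res-dim4-pi`, typ-2 g5)

[OURS · counted 0 · about OUR S3 (c) strategy; nothing about resolution of singularities] (D-0157 DOOR 2; DR-157-C; desk WORD #131 (c);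
crit-3 g4 K-A3-26b repair pre-read). After the repair blow-up of `Σ` (`…ChartAtlasSNCRepairStep`, p693365) the sheared bad member reads
`(x_m + b)·𝒪` on the `x_j`-chart — a hyperplane DISJOINT from the surviving centre `V(z, x_T)` (`m ∈ T`, `b ≠ 0`) — and the other bad
member `x_j·𝒪` has died (`⊤`). PROVED here (no `sorry`, no new axiom):

* **`hasSNCWith_cons_of_disjoint_support`** — GENERIC (any scheme): `HasSNCWith E C`, `supp D ∩ supp C = ∅` and `HasSNC (D :: E)` ⇒
  `HasSNCWith (D :: E) C` (at points of the centre `D` is absent; elsewhere only the boundary condition is asked);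
  `hasSNCWith_cons_top` — a dead member `⊤` may always be added;
* **`hasSNCWith_afterRepair_translatedHyperplanes_𝓘Λ`** — on `𝔸⁵_K`: `m ∈ T`, `b ≠ 0`, `β, c` vanishing on `{z} ∪ T` (`β_j = 0`), `l ∌ m`:
  `HasSNCWith (⊤ :: (x_m + b)·𝒪 :: [(xᵢ + βᵢ x_j + cᵢ)·𝒪 : i ∈ l]) 𝓘Λ_T` — the boundary read on the `x_j`-chart of `Bl_Σ` (dead `St(x_j·𝒪)`,
  the moved bad member, `E_Σ = x_j·𝒪` and the other members) IS snc with the surviving centre.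

With `…ChartAtlasGlue` (`hasSNCWith_of_cover_comap`, one chart covers `St(Zc)` by p693365) and the tree's `HasSNCWith.hasSNC_transform`
this is the chart-level content of «after blowing up Σ the strict transform of the escaping centre is admissible». HONEST SCOPE: chart
model; cost of the extra blow-up for the walk's measure unbooked; resolution of singularities in dimension ≥ 4 / characteristic `p` is NOT
proved anywhere in this programme. bears_on: LADDER-RESOLUTION:D157-DOOR2 (res-dim4-pi). Supports stmt-ResolutionOfSingularities-16155
(helper, S3-N2 repair).
-/

-- every declaration of this summit lives under `Summit.ResolutionOfSingularities.ResolutionOfSingularities`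
-- (summit = problem), which the duplicate-namespace linter flags; house convention (cf. the Target file).
set_option linter.dupNamespace false

noncomputable section

open MvPolynomial Finset CategoryTheory AlgebraicGeometry Opposite TopologicalSpace IsLocalRing
open AlgebraicGeometry.Scheme.IdealSheafData (ofIdealTop vanishingIdeal)

namespace Summit.ResolutionOfSingularities.ResolutionOfSingularities.Theorems.PIDim4

open Literature.AlgebraicGeometry.Resolution
open Literature.AlgebraicGeometry.Resolution.AffinePointBlowup (P A γ coord Wtop ξ)

namespace ChartDictionary

/-! ## §1 Generic: members missing the centre -/

section Generic

universe u

variable {X : Scheme.{u}} {E : List X.IdealSheafData} {C D : X.IdealSheafData}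

/-- **A boundary member DISJOINT from the centre is harmless**: `HasSNCWith E C`, `supp D ∩ supp C = ∅`, `HasSNC (D :: E)` ⇒
`HasSNCWith (D :: E) C`. -/
theorem hasSNCWith_cons_of_disjoint_support (h : HasSNCWith E C) (hD : Disjoint (D.support : Set X) (C.support : Set X))
    (hE : HasSNC (D :: E)) : HasSNCWith (D :: E) C := by
  classical
  intro x
  by_cases hx : x ∈ C.support
  · obtain ⟨hreg, u, hu, ⟨ι, hιinj, hι⟩, hC⟩ := h x
    -- at a point of the centre, `D` does not pass: the members of `D :: E` through `x` are members of `E`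
    have hmem : ∀ D' : {D' // D' ∈ D :: E ∧ x ∈ D'.support}, D'.1 ∈ E := fun D' =>
      (List.mem_cons.mp D'.2.1).resolve_left fun e =>
        Set.disjoint_left.mp hD (by rw [← e]; exact D'.2.2) hx
    refine ⟨hreg, u, hu, ⟨fun D' => ι ⟨D'.1, hmem D', D'.2.2⟩, fun D₁ D₂ heq => ?_, fun D' => hι ⟨D'.1, hmem D', D'.2.2⟩⟩, hC⟩
    exact Subtype.ext (congrArg (fun D : {D // D ∈ E ∧ x ∈ D.support} => D.1) (hιinj heq))
  · obtain ⟨hreg, u, hu, hι, -⟩ := hE x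
    exact ⟨hreg, u, hu, hι, fun h' => absurd h' hx⟩

/-- **A dead member `⊤` may always be added.** -/
theorem hasSNCWith_cons_top (h : HasSNCWith E C) : HasSNCWith (⊤ :: E) C := by
  classical
  intro x
  obtain ⟨hreg, u, hu, ⟨ι, hιinj, hι⟩, hC⟩ := h x
  have hmem : ∀ D' : {D' // D' ∈ (⊤ :: E) ∧ x ∈ D'.support}, D'.1 ∈ E := fun D' =>
    (List.mem_cons.mp D'.2.1).resolve_left fun e => by
      have h2 := D'.2.2
      rw [e, Scheme.IdealSheafData.support_top] at h2
      exact h2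
  refine ⟨hreg, u, hu, ⟨fun D' => ι ⟨D'.1, hmem D', D'.2.2⟩, fun D₁ D₂ heq => ?_, fun D' => hι ⟨D'.1, hmem D', D'.2.2⟩⟩, hC⟩
  exact Subtype.ext (congrArg (fun D : {D // D ∈ E ∧ x ∈ D.support} => D.1) (hιinj heq))

end Generic

/-! ## §2 The boundary after the repair blow-up, on the `x_j`-chart -/

variable {K : Type} [Field K] {T : Finset (Fin 4)} {j m : Fin 4} {b : K} {β c : Fin (4 + 1) → K}

/-- **THE BOUNDARY AFTER `Bl_Σ` IS SNC WITH THE SURVIVING CENTRE** (chart `x_j`): for `m ∈ T`, `b ≠ 0`, `β, c` vanishing on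
`{z} ∪ T` with `β_j = 0`, and a list `l ∌ m` of coordinates:
`HasSNCWith (⊤ :: (x_m + b)·𝒪 :: [(xᵢ + βᵢ x_j + cᵢ)·𝒪 : i ∈ l]) 𝓘Λ_T`. -/
theorem hasSNCWith_afterRepair_translatedHyperplanes_𝓘Λ (hmT : m ∈ T) (hb : b ≠ 0) (hβj : β j.succ = 0)
    (hβT : ∀ i ∈ insert (0 : Fin (4 + 1)) (Fin.succ '' (T : Set (Fin 4))), β i = 0)
    (hcT : ∀ i ∈ insert (0 : Fin (4 + 1)) (Fin.succ '' (T : Set (Fin 4))), c i = 0) (l : List (Fin (4 + 1))) (hml : m.succ ∉ l) :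
    HasSNCWith (⊤ :: ofIdealTop (Ideal.span {(γ 4 K).symm (X m.succ + C b)}) ::
        l.map fun i => ofIdealTop (Ideal.span {(γ 4 K).symm (X i + C (β i) * X j.succ + C (c i))}))
      (AffineCoordBlowup.𝓘Λ 4 K (insert 0 (Fin.succ '' (T : Set (Fin 4))))) := by
  classical
  have hmΛ : m.succ ∈ insert (0 : Fin (4 + 1)) (Fin.succ '' (T : Set (Fin 4))) :=
    Set.mem_insert_of_mem _ ⟨m, Finset.mem_coe.mpr hmT, rfl⟩
  have hβm : β m.succ = 0 := hβT _ hmΛ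
  refine hasSNCWith_cons_top (hasSNCWith_cons_of_disjoint_support
    (hasSNCWith_offShear_translatedHyperplanes_𝓘Λ (K := K) hβj hβT hcT l) ?_ ?_)
  · -- the moved member misses the centre
    rw [AffineCoordBlowup.support_𝓘Λ]
    exact disjoint_support_translate_CΛ hmΛ hb
  · -- the whole boundary is snc: it is a configuration of sheared/translated hyperplanes with distinct… indices `m :: l`,
    -- snc with the auxiliary centre `V(z)` (`T = ∅`), hence snc
    set c' : Fin (4 + 1) → K := Function.update c m.succ b with hc'
    have hβ0 : ∀ i ∈ insert (0 : Fin (4 + 1)) (Fin.succ '' ((∅ : Finset (Fin 4)) : Set (Fin 4))), β i = 0 := by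
      intro i hi
      rw [Finset.coe_empty, Set.image_empty] at hi
      rcases hi with hi | hi
      · exact hβT i (hi ▸ Set.mem_insert _ _)
      · exact absurd hi (Set.notMem_empty _)
    have hc0 : ∀ i ∈ insert (0 : Fin (4 + 1)) (Fin.succ '' ((∅ : Finset (Fin 4)) : Set (Fin 4))), c' i = 0 := by
      intro i hi
      rw [Finset.coe_empty, Set.image_empty] at hi
      rcases hi with hi | hi
      · rw [hi, hc', Function.update_of_ne (Fin.succ_ne_zero m).symm]
        exact hcT 0 (Set.mem_insert _ _)
      · exact absurd hi (Set.notMem_empty _)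
    have h0 := (hasSNCWith_offShear_translatedHyperplanes_𝓘Λ (K := K) (T := ∅) (j := j) (c := c') hβj hβ0 hc0 (m.succ :: l)).hasSNC
    rw [List.map_cons] at h0
    convert h0 using 2
    · rw [hc', Function.update_self, hβm, C_0, zero_mul, add_zero]
    · refine List.map_congr_left fun i hi => ?_
      have him : i ≠ m.succ := fun e => hml (e ▸ hi)
      rw [hc', Function.update_of_ne him]

end ChartDictionary

end Summit.ResolutionOfSingularities.ResolutionOfSingularities.Theorems.PIDim4

end
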